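import Summits.QuantumFields.GaugeBoot.Rows.GLYZc1D4Red
import Summits.QuantumFields.GaugeBoot.MMRowSU2D4
import HarnessLib

/-!
# Gauge-boot: relaxation soundness for the certified glyz-c1-rp-4D problems (rows C20–C31)

Cell `pub-gaugeboot` (HOME `run/shared/lean/pub/pub-gaugeboot/`), seat lean1 (binding layer). The `D = 4` analogue of
`GLYZc1D3Soundness`: ONE statement assembling the unit variable, the a-priori bounds, the equality rows 𝓔 (per coupling:
lean2's word rows `Eqs/GLYZc1D4B<tag>.row`, here a parameter `rows` with the hypothesis that they vanish on the torus state)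
and the 34 REDUCED positivity blocks 𝓟 (`GLYZc1D4Ent.redBlock`, PSD for the torus state by `GLYZc1D4Red`).

HONEST FRAMING (page 1 of every file of this cell): certified bounds on lattice expectations at STATED coupling,
gauge group, dimension and torus size; NOT a mass gap, NOT a continuum limit, NOT a string tension, NOT large `N`.
The venture is explicitly NOT Yang–Mills-summit-bearing (barriers `FixedCouplingUltralocality`,
`PerturbativeInvisibility`).

## Content

* `Feasible rows β z`: a word-indexed real assignment `z` satisfies every constraint of the certsdp problem
  `certs/SU2-D4/glyz-c1/beta-<p>-<q>-{upper,lower}.problem1.json` whose 204 equality rows are `rows` (word form): unit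
  variable, `|z| ≤ 1` on the 1079 labelled variables, the rows at coupling `β`, and positive semidefiniteness of the 34
  reduced blocks with the variables `v ↦ z (label v)`.
* **`feasible_of`** (RELAXATION SOUNDNESS): for every real `β_std ≥ 0`, every even torus `(ℤ/L)⁴` with `L ≥ 4`, and every
  row family vanishing on the torus state (lean2's `rowSum4_row`), the Wilson–Haar loop expectations `w ↦ ⟨W_0(w)⟩_β` are
  `Feasible`. Hence any valid bound on the objective over the feasible set — the exact dual certificates, kernel-replayed
  by lean3 (`Certificates/N2c1D4b<tag>{Up,Lo}`) — is a bound on the torus plaquette expectation: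
  `plaquetteExpectation_le_of_upperClaim`, `le_plaquetteExpectation_of_lowerClaim`, `t2_of_claims` (shape (A), `L₀ = 4`).
  The per-β END-TO-END theorems are `GLYZc1D4BindB<tag>.t2_C<k>`.
-/

noncomputable section

open Literature.MathematicalPhysics.QuantumFieldTheory

namespace Summit.QuantumFields.GaugeBoot

namespace GLYZc1D4

/-- A word row evaluated on a word-indexed assignment `z` at coupling `β`: `∑ (c0 + c1·β/8) · z w`. -/
def rowEval (β : ℝ) (z : Word 4 → ℝ) (r : ERow4) : ℝ :=
  (r.map fun t => (((t.2.1 : ℚ) : ℝ) + ((t.2.2 : ℚ) : ℝ) * (β / 8)) * z t.1).sum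

/-- The plaquette word (problem column `1`, the objective variable). -/
abbrev plaq : Word 4 := [.fwd 0, .fwd 1, .bwd 0, .bwd 1]

/-- **Feasibility for a certified glyz-c1-rp-4D problem** with equality rows `rows` (word form) at coupling `β`, for a
word-indexed assignment `z` (both senses of one window row share the constraints). -/
structure Feasible (rows : ℕ → ERow4) (β : ℝ) (z : Word 4 → ℝ) : Prop where
  /-- the unit variable (column `0`, empty word) -/
  unit : z [] = 1
  /-- a-priori bounds `|y_v| ≤ 1` on all 1079 variables -/
  abs_le : ∀ v : Fin 1079, |z (label v)| ≤ 1
  /-- the 204 equality rows (𝓔) -/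
  eqs : ∀ j < 204, rowEval β z (rows j) = 0
  /-- the 34 reduced positivity blocks (𝓟) in the variables `v ↦ z (label v)` are positive semidefinite -/
  psd : ∀ k : Fin 34, (redBlock k fun v => z (label v)).PosSemidef

variable (β : ℝ) (L : ℕ) [NeZero L]

/-- `rowEval` on the torus expectations is `rowSum4`. -/
theorem rowEval_W (r : ERow4) : rowEval β (Rung0D4.W β L) r = rowSum4 β L r := rfl

/-- `⟨W_0(∅)⟩ = 1`. -/
theorem W_nil : Rung0D4.W β L [] = 1 := by
  have h := y_zero β L
  rwa [y, label_zero] at h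

/-- **Relaxation soundness.** On every even torus `(ℤ/L)⁴` with `L ≥ 4` and at every standard coupling `β_std ≥ 0`, the
Wilson–Haar loop expectations `w ↦ ⟨W_0(w)⟩_β` of `SU(2)` lattice gauge theory satisfy every constraint of a certified
glyz-c1-rp-4D problem whose rows vanish on the torus state. -/
theorem feasible_of (rows : ℕ → ERow4) (hrows : ∀ j < 204, rowSum4 β L (rows j) = 0) (hβ : 0 ≤ β) (hL : Even L)
    (h4 : 4 ≤ L) : Feasible rows β (Rung0D4.W β L) where
  unit := W_nil β L
  abs_le v := abs_y_le_one β L v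
  eqs j hj := by rw [rowEval_W]; exact hrows j hj
  psd k := redBlock_posSemidef β L hβ hL h4 k

/-- The readers'/replay statement for an UPPER certificate: every feasible assignment has plaquette value `≤ b`. -/
def UpperClaim (rows : ℕ → ERow4) (β b : ℝ) : Prop := ∀ z : Word 4 → ℝ, Feasible rows β z → z plaq ≤ b

/-- The statement for a LOWER certificate. -/
def LowerClaim (rows : ℕ → ERow4) (β a : ℝ) : Prop := ∀ z : Word 4 → ℝ, Feasible rows β z → a ≤ z plaq

/-- **Upper end, named-hypothesis form**: an upper claim at `β_std ≥ 0` for rows vanishing on the torus state bounds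
`⟨ū_P⟩` on every even torus `(ℤ/L)⁴`, `L ≥ 4`. -/
theorem plaquetteExpectation_le_of_upperClaim {rows : ℕ → ERow4} {b : ℝ} (h : UpperClaim rows β b)
    (hrows : ∀ j < 204, rowSum4 β L (rows j) = 0) (hβ : 0 ≤ β) (hL : Even L) (h4 : 4 ≤ L) :
    plaquetteExpectation 2 4 L β ≤ b := by
  rw [plaquetteExpectation_eq_W]
  exact h _ (feasible_of β L rows hrows hβ hL h4)

/-- **Lower end, named-hypothesis form.** -/
theorem le_plaquetteExpectation_of_lowerClaim {rows : ℕ → ERow4} {a : ℝ} (h : LowerClaim rows β a)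
    (hrows : ∀ j < 204, rowSum4 β L (rows j) = 0) (hβ : 0 ≤ β) (hL : Even L) (h4 : 4 ≤ L) :
    a ≤ plaquetteExpectation 2 4 L β := by
  rw [plaquetteExpectation_eq_W]
  exact h _ (feasible_of β L rows hrows hβ hL h4)

/-- **Shape (A) window from the two claims** (`T2 = PlaquetteWindow 2 4`, threshold `L₀ = 4`). -/
theorem t2_of_claims {rows : ℕ → ERow4} {β a b : ℝ} (hβ : 0 ≤ β)
    (hrows : ∀ (L : ℕ) [NeZero L], 4 ≤ L → ∀ j < 204, rowSum4 β L (rows j) = 0)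
    (hu : UpperClaim rows β b) (hl : LowerClaim rows β a) : T2 4 β a b :=
  fun L _ hL h4 => ⟨le_plaquetteExpectation_of_lowerClaim β L hl (hrows L h4) hβ hL h4,
    plaquetteExpectation_le_of_upperClaim β L hu (hrows L h4) hβ hL h4⟩

end GLYZc1D4

end Summit.QuantumFields.GaugeBoot

end
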